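import Summits.BirchSwinnertonDyer.Rank1Residual.Additive.TypeGThree
import Summits.BirchSwinnertonDyer.Rank1Residual.AdditivePotMult.RankZeroChiBranch
import HarnessLib

/-!
# X4♯(G-ord) / X3♯(G-ord), defect 2, analytic rank `0`: the UPPER half of `BSD(E,p)` from the typed
# `χ_p`-branch input ALONE — the (G)-twin of additive-p1's `RankZeroChiBranch.lean`

HONEST FRAMING (cell `b2b-bsdres`, run/shared/lean/b2b/bsd-rank1-residual/, verbatim in every
file): the goal of the cell is to DELETE the COMBINATION-SHAPED residual classes of the
Birch–Swinnerton-Dyer formula for ALL analytic-rank `≤ 1` elliptic curves over `ℚ` — "full BSD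
formula for every rank `≤ 1` curve in class `C`" assembled STRICTLY from published theorems — so
that the rank-`≤ 1` remainder becomes exactly the CONSTRUCTION-SHAPED classes, which are TYPED
(missing-input `Prop`s), NOT attempted. This is not "finishing BSD". Sub-cell `additive-p2`
(CLASS-OWNERS row "X3/X4 additive — pot. good ordinary / X3♯(G-ord)"), generation 7: research
route; no claim beyond the stated classes; theorems only, no definition, no new named fact;
X3♯(G-ord)/X4♯(G-ord) stay CONSTRUCTION-SHAPED; labels / census / located gap UNCHANGED.

WHAT THIS FILE DOES (additive-p1 GEN 6's request, INBOX 2026-08-20T13:15Z: "the (G-ord, e = 2) twin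
… the same class-level consumers of additive-p4's chain can be written for X4♯(G-ord) verbatim").
Seat additive-p4's branch-side line V9/V9b (`X4RankZeroTwist.missingUpperBoundAt_of_odd_prime_of_surj`,
`X3RankZeroTwist.missingUpperBoundAt_of_odd_prime`; Delbourgo 1998 Prop. 4 = tree fact
`Delbourgo1998.prop4_rankZero_pow_dvd_constantCoeff`, plus the TYPED `χ_p`-branch inputs
`ChiBranchLeadingTerm[Odd][BigImage]At W p` = "[B∘C] at `T = 0`") takes as DATA a globally minimal
`V`, GOOD ORDINARY or multiplicative at `p`, with `W ≅ V^{(p*)}`, its newform and two rational period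
ratios. On the defect-2 cell of X3♯(G-ord)/X4♯(G-ord) that datum EXISTS as a kernel theorem — `V` = a
globally minimal model of `E^{(p*)}`, good ORDINARY at `p` by gen 4's
`exists_goodOrd_twist_pStar_of_typeGOrd` (`p ≥ 5`, `e = 2`) and by gen 7's
`goodOrd_twist_three_of_typeGOrd` (`p = 3`, Tate's algorithm), turned round by the twist involution
`(E^{(p*)})^{(p*)} ≅ E` (`exists_variableChange_twist_of_model_twist`):

* `TypeGOrd.exists_goodOrd_pStar_twist_model`, `ClassX4Gord.…`, `ClassX3Gord.…` — the datum
  `(V, C, GoodOrd V p)` with `C • V^{(p*)} = W` for every (G)-ordinary additive pair with `e = 2`, odd `p`;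
* `ClassX4Gord.missingUpperBoundAt_rankZero_of_chiBranch` — `(E,p) ∈ X4♯(G-ord)`, `e = 2`, `r_an = 0`,
  `ρ̄_{E,p}` onto (and `ram(3)` if `p = 3`): **`Typed.MissingUpperBoundAt W p` from the typed branch
  input alone** — NO `p ∤ ∏ c_ℓ`, NO Manin datum, both parities of `p`, `p = 3` included;
* `ClassX4Gord.bsdp_rankZero_of_chiBranch_of_shaAn_unit` — hence `BSD(E,p)` on the `p ∤ #Ш_an`
  rows (the Tamagawa-obstructed rank-zero X4♯(G-ord) pairs, out of reach of Kim 2026 Thm. 1.8 and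
  of gen 3's `bsdp_iff_lowerOverC_of_classX4Gord_two_of_kim`, get a route modulo ONE typed input);
* `ClassX4Gord.missingInputAt_iff_lower_rankZero_of_chiBranch`, `…bsdp_rankZero_of_chiBranch_of_lower`
  — what then remains is EXACTLY the lower half over `ℚ` = the lower half of the over-`K` input of
  gen 3's `bsdp_iff_lowerOverC_of_classX4Gord_two_of_kim` WITHOUT its Tamagawa/Manin hypotheses;
* `ClassX3Gord.missingUpperBoundAt_rankZero_of_chiBranch` / `…bsdp_rankZero_of_chiBranch_of_shaAn_unit`
  — the X3♯(G-ord) twins (Wuthrich 2014 Thm. 16 side; extra `p ∤ c_p(E)` as in additive-p4's X3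
  statement); §4: on this cell `p ∤ c_p(E)` is AUTOMATIC (Kodaira `I₀*`, additive-p4's
  `not_dvd_tamagawaNumberAt_twist_pm_p`) — primed versions without it, and
  `ClassX3Gord.missingInputAt_iff_lower_rankZero_of_chiBranch`.

Located gap UNCHANGED (AUDIT-X34-GORD.md §3, one object in three guises): the typed branch input is
the `ω^{(p−1)/2}`-branch (`χ_p`-eigenspace) Eisenstein divisibility for the good ordinary twist
`E^{(p*)}` — Kato Thm. 17.4 gives the Euler-system half on every branch; the converse is printed
only on the trivial branch (SU 2014 Thm. 3.6.4) and ANNOUNCED on the `χ_K`-branch by BSTW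
arXiv:2409.01350 Thm. 1.21(c) (PRE). Labels UNCHANGED; nothing booked.

References: D. Delbourgo, Compositio Math. 113 (1998) Prop. 4 (p. 144), Lemma (ii) (p. 139);
B. Edixhoven, in: Arithmetic Algebraic Geometry (1991) §1 (Manin constant / period lattice);
C. Wuthrich, Doc. Math. 19 (2014) 381–402, Thm. 16; J. H. Silverman, *AEC* X.5 Cor. 5.4.
-/

noncomputable section

open scoped Classical MatrixGroups ModularForm NumberField

open CongruenceSubgroup WeierstrassCurve NumberField Literature.NumberTheory.EllipticCurves
  Literature.NumberTheory.EllipticCurves.ModularForms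
  Literature.NumberTheory.EllipticCurves.Rank1Residual
  Literature.NumberTheory.EllipticCurves.Rank1Residual.Typed
  IsDedekindDomain Rat.HeightOneSpectrum

namespace Summit.BirchSwinnertonDyer.Rank1Residual.Additive

/-! ### §0 The twist involution on models -/

/-- **Twisting twice by `d` returns to the curve, on models**: if `C₁ • W^{(d)} = V` (`d ≠ 0`) then
`C • V^{(d)} = W` for some change of variables `C` over the same field
(`V^{(d)} = (C₁ • W^{(d)})^{(d)} = C' • W^{(d·d)}` and `W^{(1·d²)} ≅ W^{(1)} ≅ W`; tree
`quadraticTwist_smul`, `quadraticTwist_quadraticTwist`, `exists_variableChange_quadraticTwist_mul_sq`,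
`exists_variableChange_quadraticTwist_one`). [cite: SilvermanAEC2009, X.5 Cor. 5.4] -/
theorem exists_variableChange_twist_of_model_twist (W : WeierstrassCurve ℚ) {d : ℚ} (hd : d ≠ 0)
    {V : WeierstrassCurve ℚ} {C₁ : VariableChange ℚ} (hC₁ : C₁ • W.quadraticTwist d = V) :
    ∃ C : VariableChange ℚ, C • V.quadraticTwist d = W := by
  haveI : NeZero (2 : ℚ) := ⟨two_ne_zero⟩
  obtain ⟨C₂, hC₂⟩ := W.exists_variableChange_quadraticTwist_mul_sq 1 d hd
  obtain ⟨C₀, hC₀⟩ := W.exists_variableChange_quadraticTwist_one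
  have hV : V.quadraticTwist d = ((⟨C₁.u, d * C₁.r, 0, 0⟩ : VariableChange ℚ) * C₂ * C₀) • W := by
    rw [← hC₁, quadraticTwist_smul, quadraticTwist_quadraticTwist, mul_smul, mul_smul, hC₀, hC₂,
      one_mul, sq]
  refine ⟨((⟨C₁.u, d * C₁.r, 0, 0⟩ : VariableChange ℚ) * C₂ * C₀)⁻¹, ?_⟩
  rw [hV, smul_smul, inv_mul_cancel, one_smul]

variable (W : WeierstrassCurve ℚ) [W.IsElliptic] [W.IsGloballyMinimal] (p : ℕ) [hp : Fact p.Prime]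

/-! ### §1 The good ORDINARY twist model of a (G)-ordinary pair of defect 2 -/

/-- **The good-ordinary twist model of a (G)-ORDINARY additive pair of defect `2`** (odd `p`): for
`E` additive at `p` with `TypeGOrd W p` and `semistabilityIndex W p = 2` there are a globally minimal
`V/ℚ`, GOOD ORDINARY at `p`, and `C` with `C • V^{(p*)} = W`, `p* = (−1)^{⌊p/2⌋} p`. `V` is a minimal
model of `E^{(p*)}` — good ordinary by gen 4's `exists_goodOrd_twist_pStar_of_typeGOrd` for `p ≥ 5`
and by gen 7's `goodOrd_twist_three_of_typeGOrd` (Tate's algorithm at `3`) for `p = 3` — turned round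
by the twist involution. This is exactly the datum `(V, C, GoodOrd V p)` of additive-p4's
`X4RankZeroTwist.*` / `X3RankZeroTwist.*` theorems (line V9/V9b). -/
theorem TypeGOrd.exists_goodOrd_pStar_twist_model (hp2 : p ≠ 2) (hG : TypeGOrd W p)
    (hadd : Addv W p) (he : semistabilityIndex W p = 2) :
    ∃ (V : WeierstrassCurve ℚ) (_ : V.IsElliptic) (_ : V.IsGloballyMinimal) (C : VariableChange ℚ),
      GoodOrd V p ∧ C • V.quadraticTwist ((-1 : ℚ) ^ (p / 2) * p) = W := by
  have hps0 : ((-1 : ℚ) ^ (p / 2) * p) ≠ 0 := pStar_ne_zero p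
  by_cases hp3 : p = 3
  · subst hp3
    haveI := W.isElliptic_quadraticTwist hps0
    obtain ⟨C₁, hCmin⟩ :=
      hasGlobalMinimalModel_rat_holds (W.quadraticTwist ((-1 : ℚ) ^ ((3 : ℕ) / 2) * (3 : ℕ)))
    haveI := hCmin
    set V := C₁ • W.quadraticTwist ((-1 : ℚ) ^ ((3 : ℕ) / 2) * (3 : ℕ)) with hVdef
    have hC₁ : C₁ • W.quadraticTwist ((-1 : ℚ) ^ ((3 : ℕ) / 2) * (3 : ℕ)) = V := rfl
    have hord : GoodOrd V 3 := goodOrd_twist_three_of_typeGOrd W hG hadd V ⟨C₁, hC₁⟩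
    obtain ⟨C, hC⟩ := exists_variableChange_twist_of_model_twist W hps0 hC₁
    exact ⟨V, inferInstance, hCmin, C, hord, hC⟩
  · have hp5 : 5 ≤ p := by
      have h2 := hp.out.two_le
      rcases Nat.lt_or_ge p 5 with h | h
      · interval_cases p <;> first | omega | exact absurd hp.out (by decide)
      · exact h
    obtain ⟨V, iV, iVm, C₁, hC₁, hord⟩ := exists_goodOrd_twist_pStar_of_typeGOrd W p hp5 hG he
    obtain ⟨C, hC⟩ := exists_variableChange_twist_of_model_twist W hps0 hC₁
    exact ⟨V, iV, iVm, C, hord, hC⟩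

/-- **X4♯(G-ord) ∩ `I₀*`: the good-ordinary twist model** (`C • V^{(p*)} = W`, `GoodOrd V p`). -/
theorem ClassX4Gord.exists_goodOrd_pStar_twist_model (hX : ClassX4Gord W p)
    (he : semistabilityIndex W p = 2) :
    ∃ (V : WeierstrassCurve ℚ) (_ : V.IsElliptic) (_ : V.IsGloballyMinimal) (C : VariableChange ℚ),
      GoodOrd V p ∧ C • V.quadraticTwist ((-1 : ℚ) ^ (p / 2) * p) = W :=
  TypeGOrd.exists_goodOrd_pStar_twist_model W p hX.addv.1 hX.typeGOrd hX.addv.2 he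

/-- **X3♯(G-ord) ∩ `I₀*` (odd `p`): the good-ordinary twist model.** -/
theorem ClassX3Gord.exists_goodOrd_pStar_twist_model (hp2 : p ≠ 2) (hX : ClassX3Gord W p)
    (he : semistabilityIndex W p = 2) :
    ∃ (V : WeierstrassCurve ℚ) (_ : V.IsElliptic) (_ : V.IsGloballyMinimal) (C : VariableChange ℚ),
      GoodOrd V p ∧ C • V.quadraticTwist ((-1 : ℚ) ^ (p / 2) * p) = W :=
  TypeGOrd.exists_goodOrd_pStar_twist_model W p hp2 hX.typeGOrd hX.addv he

variable {W p}

/-! ### §2 X4♯(G-ord), rank `0`: the upper half from the branch input alone -/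

/-- **X4♯(G-ord) ∩ `I₀*`, `r_an = 0`, big image: `Typed.MissingUpperBoundAt W p` from the typed
`χ_p`-branch input ALONE.** For `(E,p) ∈ X4♯(G-ord)` with `e_E(p) = 2`, `ord_{s=1} L(E,s) = 0`,
`ρ̄_{E,p}` onto and `ram(3)` when `p = 3`: granted the typed inputs `ChiBranchLeadingTermBigImageAt W p`
(used iff `p ≡ 1 (mod 4)`) / `ChiBranchLeadingTermOddBigImageAt W p` (iff `p ≡ 3 (mod 4)`),
`ord_p #Ш(E) ≤ ord_p #Ш_an(E)`. The semistable-twist datum of additive-p4's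
`X4RankZeroTwist.missingUpperBoundAt_of_odd_prime_of_surj` is DISCHARGED
(`ClassX4Gord.exists_goodOrd_pStar_twist_model`; newform and period ratios from `hmodD`). Other
inputs: Delbourgo 1998 Prop. 4 (`hDel`), GZK, modularity. NO Tamagawa, NO Manin hypothesis.
X4♯(G-ord) stays CONSTRUCTION-SHAPED. [cite: Delbourgo1998, Prop. 4 (p. 144) and Lemma (ii) (p. 139)]
[cite: EdixhovenManin1991, §1] -/
theorem ClassX4Gord.missingUpperBoundAt_rankZero_of_chiBranch
    (hDel : Delbourgo1998.prop4_rankZero_pow_dvd_constantCoeff)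
    (hGZK : rank_eq_analyticRank_of_analyticRank_le_one) (hmod : hasEntireLFunction_rat)
    (hmodD : nonempty_modularParametrizationData)
    (hBCeven : ChiBranchLeadingTermBigImageAt W p) (hBCodd : ChiBranchLeadingTermOddBigImageAt W p)
    (hX : ClassX4Gord W p) (he : semistabilityIndex W p = 2) (hr : W.analyticRank = 0)
    (hsurj : Surj W p) (hram3 : p = 3 → Ram W p) :
    MissingUpperBoundAt W p := by
  obtain ⟨V, iV, iVm, C, hV, hC⟩ := hX.exists_goodOrd_pStar_twist_model W p he
  haveI : NeZero (V.conductorNorm ℤ) := ⟨(V.conductorNorm_pos_holds).ne'⟩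
  obtain ⟨Dm⟩ := hmodD V
  obtain ⟨ϖ, -, hϖ, -⟩ := Dm.exists_rat_mul_realPeriodRat_eq_plusPeriod
  obtain ⟨ϖ', -, hϖ'⟩ := exists_rat_mul_imaginaryPeriodRat_eq_minusPeriod Dm
  exact X4RankZeroTwist.missingUpperBoundAt_of_odd_prime_of_surj W p hDel hGZK hmod hBCeven hBCodd
    hX.addv.1 hr hX.classX4 hsurj hram3 V C hC (Or.inl hV) Dm.isNewformOf ϖ hϖ ϖ' hϖ'

/-- **X4♯(G-ord) ∩ `I₀*`, `r_an = 0`, big image, `p ∤ #Ш_an(E)`: `BSD(E,p)` from the typed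
`χ_p`-branch input alone** — in particular on the TAMAGAWA-OBSTRUCTED rank-zero pairs (`p ∣ c_ℓ`
at some `ℓ ≠ p`), which neither Kim 2026 Thm. 1.8 nor gen 3's one-sided relocation reaches.
[cite: Delbourgo1998, Prop. 4 (p. 144)] -/
theorem ClassX4Gord.bsdp_rankZero_of_chiBranch_of_shaAn_unit
    (hDel : Delbourgo1998.prop4_rankZero_pow_dvd_constantCoeff)
    (hGZK : rank_eq_analyticRank_of_analyticRank_le_one) (hmod : hasEntireLFunction_rat)
    (hmodD : nonempty_modularParametrizationData)
    (hBCeven : ChiBranchLeadingTermBigImageAt W p) (hBCodd : ChiBranchLeadingTermOddBigImageAt W p)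
    (hX : ClassX4Gord W p) (he : semistabilityIndex W p = 2) (hr : W.analyticRank = 0)
    (hsurj : Surj W p) (hram3 : p = 3 → Ram W p)
    {q : ℚ} (hq : shaAn W = (q : ℂ)) (hv : padicValRat p q = 0) : BSDp W p :=
  bsdp_of_missingPPartAt W p hGZK (by rw [hr]; exact zero_le_one)
    (missingPPartAt_of_upper_of_shaAn_unit W p
      (ClassX4Gord.missingUpperBoundAt_rankZero_of_chiBranch hDel hGZK hmod hmodD hBCeven hBCodd hX
        he hr hsurj hram3) hq hv)

/-- **X4♯(G-ord) ∩ `I₀*`, `r_an = 0`, big image: what remains is EXACTLY the lower half** —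
`Typed.X4.MissingInputAt W p ⟺ MissingLowerBoundAt W p`, granted the branch input.
[cite: Delbourgo1998, Prop. 4 (p. 144)] -/
theorem ClassX4Gord.missingInputAt_iff_lower_rankZero_of_chiBranch
    (hDel : Delbourgo1998.prop4_rankZero_pow_dvd_constantCoeff)
    (hGZK : rank_eq_analyticRank_of_analyticRank_le_one) (hmod : hasEntireLFunction_rat)
    (hmodD : nonempty_modularParametrizationData)
    (hBCeven : ChiBranchLeadingTermBigImageAt W p) (hBCodd : ChiBranchLeadingTermOddBigImageAt W p)
    (hX : ClassX4Gord W p) (he : semistabilityIndex W p = 2) (hr : W.analyticRank = 0)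
    (hsurj : Surj W p) (hram3 : p = 3 → Ram W p) :
    X4.MissingInputAt W p ↔ MissingLowerBoundAt W p := by
  obtain ⟨V, iV, iVm, C, hV, hC⟩ := hX.exists_goodOrd_pStar_twist_model W p he
  haveI : NeZero (V.conductorNorm ℤ) := ⟨(V.conductorNorm_pos_holds).ne'⟩
  obtain ⟨Dm⟩ := hmodD V
  obtain ⟨ϖ, -, hϖ, -⟩ := Dm.exists_rat_mul_realPeriodRat_eq_plusPeriod
  obtain ⟨ϖ', -, hϖ'⟩ := exists_rat_mul_imaginaryPeriodRat_eq_minusPeriod Dm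
  exact X4RankZeroTwist.missingPPartAt_iff_lower_of_odd_prime_of_surj W p hDel hGZK hmod hBCeven
    hBCodd hX.addv.1 hr hX.classX4 hsurj hram3 V C hC (Or.inl hV) Dm.isNewformOf ϖ hϖ ϖ' hϖ'

/-- **X4♯(G-ord) ∩ `I₀*`, `r_an = 0`, big image: `BSD(E,p)` from the branch input and the LOWER
half over `ℚ`** (no Tamagawa / Manin hypothesis). [cite: Delbourgo1998, Prop. 4 (p. 144)] -/
theorem ClassX4Gord.bsdp_rankZero_of_chiBranch_of_lower
    (hDel : Delbourgo1998.prop4_rankZero_pow_dvd_constantCoeff)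
    (hGZK : rank_eq_analyticRank_of_analyticRank_le_one) (hmod : hasEntireLFunction_rat)
    (hmodD : nonempty_modularParametrizationData)
    (hBCeven : ChiBranchLeadingTermBigImageAt W p) (hBCodd : ChiBranchLeadingTermOddBigImageAt W p)
    (hX : ClassX4Gord W p) (he : semistabilityIndex W p = 2) (hr : W.analyticRank = 0)
    (hsurj : Surj W p) (hram3 : p = 3 → Ram W p) (hlow : MissingLowerBoundAt W p) : BSDp W p :=
  bsdp_of_missingPPartAt W p hGZK (by rw [hr]; exact zero_le_one)
    ((ClassX4Gord.missingInputAt_iff_lower_rankZero_of_chiBranch hDel hGZK hmod hmodD hBCeven hBCodd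
      hX he hr hsurj hram3).mpr hlow)

/-! ### §3 X3♯(G-ord), rank `0`: the upper half from the branch input (Wuthrich Thm. 16 side) -/

/-- **X3♯(G-ord) ∩ `I₀*` (odd `p`), `r_an = 0`: `Typed.MissingUpperBoundAt W p` from the typed
`χ_p`-branch input** (`ChiBranchLeadingTermAt` / `ChiBranchLeadingTermOddAt`, the reducible =
Wuthrich 2014 Thm. 16 side of line V9) and `p ∤ c_p(E)`: the semistable-twist datum of
additive-p4's `X3RankZeroTwist.missingUpperBoundAt_of_odd_prime` is DISCHARGED
(`ClassX3Gord.exists_goodOrd_pStar_twist_model`). X3♯(G-ord) stays CONSTRUCTION-SHAPED.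
[cite: Delbourgo1998, Prop. 4 (p. 144)] [cite: Wuthrich2014, Thm. 16 (p. 397) (shape only; nothing asserted)] -/
theorem ClassX3Gord.missingUpperBoundAt_rankZero_of_chiBranch
    (hDel : Delbourgo1998.prop4_rankZero_pow_dvd_constantCoeff)
    (hGZK : rank_eq_analyticRank_of_analyticRank_le_one) (hmod : hasEntireLFunction_rat)
    (hmodD : nonempty_modularParametrizationData)
    (hBCeven : ChiBranchLeadingTermAt W p) (hBCodd : ChiBranchLeadingTermOddAt W p)
    (hp2 : p ≠ 2) (hX : ClassX3Gord W p) (he : semistabilityIndex W p = 2) (hr : W.analyticRank = 0)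
    (htam : ¬ p ∣ W.tamagawaNumberAt ((primesEquiv (R := 𝓞 ℚ)).symm ⟨p, hp.out⟩)) :
    MissingUpperBoundAt W p := by
  obtain ⟨V, iV, iVm, C, hV, hC⟩ := hX.exists_goodOrd_pStar_twist_model W p hp2 he
  haveI : NeZero (V.conductorNorm ℤ) := ⟨(V.conductorNorm_pos_holds).ne'⟩
  obtain ⟨Dm⟩ := hmodD V
  obtain ⟨ϖ, -, hϖ, -⟩ := Dm.exists_rat_mul_realPeriodRat_eq_plusPeriod
  obtain ⟨ϖ', -, hϖ'⟩ := exists_rat_mul_imaginaryPeriodRat_eq_minusPeriod Dm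
  exact X3RankZeroTwist.missingUpperBoundAt_of_odd_prime W p hDel hGZK hmod hBCeven hBCodd hp2 hr
    hX.classX3 V C hC (Or.inl hV) Dm.isNewformOf ϖ hϖ ϖ' hϖ' htam

/-- **X3♯(G-ord) ∩ `I₀*` (odd `p`), `r_an = 0`, `p ∤ c_p(E) · #Ш_an(E)`: `BSD(E,p)` from the typed
`χ_p`-branch input.** [cite: Delbourgo1998, Prop. 4 (p. 144)] -/
theorem ClassX3Gord.bsdp_rankZero_of_chiBranch_of_shaAn_unit
    (hDel : Delbourgo1998.prop4_rankZero_pow_dvd_constantCoeff)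
    (hGZK : rank_eq_analyticRank_of_analyticRank_le_one) (hmod : hasEntireLFunction_rat)
    (hmodD : nonempty_modularParametrizationData)
    (hBCeven : ChiBranchLeadingTermAt W p) (hBCodd : ChiBranchLeadingTermOddAt W p)
    (hp2 : p ≠ 2) (hX : ClassX3Gord W p) (he : semistabilityIndex W p = 2) (hr : W.analyticRank = 0)
    (htam : ¬ p ∣ W.tamagawaNumberAt ((primesEquiv (R := 𝓞 ℚ)).symm ⟨p, hp.out⟩))
    {q : ℚ} (hq : shaAn W = (q : ℂ)) (hv : padicValRat p q = 0) : BSDp W p :=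
  bsdp_of_missingPPartAt W p hGZK (by rw [hr]; exact zero_le_one)
    (missingPPartAt_of_upper_of_shaAn_unit W p
      (ClassX3Gord.missingUpperBoundAt_rankZero_of_chiBranch hDel hGZK hmod hmodD hBCeven hBCodd hp2
        hX he hr htam) hq hv)

/-! ### §4 X3♯(G-ord): the local Tamagawa hypothesis `p ∤ c_p(E)` is automatic (Kodaira `I₀*`) -/

variable (p) in
omit hp in
/-- `p* = (−1)^{⌊p/2⌋} p` is `p` or `−p`. -/
theorem pStar_eq_self_or_neg : ((-1 : ℚ) ^ (p / 2) * p) = p ∨ ((-1 : ℚ) ^ (p / 2) * p) = -(p : ℚ) := by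
  rcases neg_one_pow_eq_or ℚ (p / 2) with h | h <;> rw [h]
  · left; ring
  · right; ring

variable (W p) in
/-- **On the defect-2 (G)-ordinary cell the local Tamagawa number at `p` is prime to `p`**
(`p` odd): `W ≅ V^{(p*)}` with `V` good at `p` (`TypeGOrd.exists_goodOrd_pStar_twist_model`), so
`c_p(W) ∈ {1, 2, 4}` by additive-p4's kernel Tate algorithm `not_dvd_tamagawaNumberAt_twist_pm_p`
(Kodaira `I₀*`). -/
theorem TypeGOrd.not_dvd_tamagawaNumberAt_of_semistabilityIndex_eq_two (hp2 : p ≠ 2)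
    (hG : TypeGOrd W p) (hadd : Addv W p) (he : semistabilityIndex W p = 2) :
    ¬ p ∣ W.tamagawaNumberAt ((primesEquiv (R := 𝓞 ℚ)).symm ⟨p, hp.out⟩) := by
  obtain ⟨V, iV, iVm, C, hV, hC⟩ := TypeGOrd.exists_goodOrd_pStar_twist_model W p hp2 hG hadd he
  exact not_dvd_tamagawaNumberAt_twist_pm_p p hp2 V (Or.inl hV.1) (pStar_eq_self_or_neg p) C hC

/-- **X3♯(G-ord) ∩ `I₀*` (odd `p`), `r_an = 0`: `Typed.MissingUpperBoundAt W p` from the typed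
`χ_p`-branch input ALONE** — `ClassX3Gord.missingUpperBoundAt_rankZero_of_chiBranch` with its
hypothesis `p ∤ c_p(E)` DISCHARGED (`TypeGOrd.not_dvd_tamagawaNumberAt_of_semistabilityIndex_eq_two`).
[cite: Delbourgo1998, Prop. 4 (p. 144)] -/
theorem ClassX3Gord.missingUpperBoundAt_rankZero_of_chiBranch'
    (hDel : Delbourgo1998.prop4_rankZero_pow_dvd_constantCoeff)
    (hGZK : rank_eq_analyticRank_of_analyticRank_le_one) (hmod : hasEntireLFunction_rat)
    (hmodD : nonempty_modularParametrizationData)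
    (hBCeven : ChiBranchLeadingTermAt W p) (hBCodd : ChiBranchLeadingTermOddAt W p)
    (hp2 : p ≠ 2) (hX : ClassX3Gord W p) (he : semistabilityIndex W p = 2) (hr : W.analyticRank = 0) :
    MissingUpperBoundAt W p :=
  ClassX3Gord.missingUpperBoundAt_rankZero_of_chiBranch hDel hGZK hmod hmodD hBCeven hBCodd hp2 hX he hr
    (TypeGOrd.not_dvd_tamagawaNumberAt_of_semistabilityIndex_eq_two W p hp2 hX.typeGOrd hX.addv he)

/-- **X3♯(G-ord) ∩ `I₀*` (odd `p`), `r_an = 0`, `p ∤ #Ш_an(E)`: `BSD(E,p)` from the typed `χ_p`-branch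
input ALONE** (no Tamagawa hypothesis at all). [cite: Delbourgo1998, Prop. 4 (p. 144)] -/
theorem ClassX3Gord.bsdp_rankZero_of_chiBranch_of_shaAn_unit'
    (hDel : Delbourgo1998.prop4_rankZero_pow_dvd_constantCoeff)
    (hGZK : rank_eq_analyticRank_of_analyticRank_le_one) (hmod : hasEntireLFunction_rat)
    (hmodD : nonempty_modularParametrizationData)
    (hBCeven : ChiBranchLeadingTermAt W p) (hBCodd : ChiBranchLeadingTermOddAt W p)
    (hp2 : p ≠ 2) (hX : ClassX3Gord W p) (he : semistabilityIndex W p = 2) (hr : W.analyticRank = 0)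
    {q : ℚ} (hq : shaAn W = (q : ℂ)) (hv : padicValRat p q = 0) : BSDp W p :=
  ClassX3Gord.bsdp_rankZero_of_chiBranch_of_shaAn_unit hDel hGZK hmod hmodD hBCeven hBCodd hp2 hX he hr
    (TypeGOrd.not_dvd_tamagawaNumberAt_of_semistabilityIndex_eq_two W p hp2 hX.typeGOrd hX.addv he)
    hq hv

/-- **X3♯(G-ord) ∩ `I₀*` (odd `p`), `r_an = 0`: what remains is EXACTLY the lower half over `ℚ`**
(`Gord.MissingInputAt W p ↔ MissingLowerBoundAt W p`, granted the branch input).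
[cite: Delbourgo1998, Prop. 4 (p. 144)] -/
theorem ClassX3Gord.missingInputAt_iff_lower_rankZero_of_chiBranch
    (hDel : Delbourgo1998.prop4_rankZero_pow_dvd_constantCoeff)
    (hGZK : rank_eq_analyticRank_of_analyticRank_le_one) (hmod : hasEntireLFunction_rat)
    (hmodD : nonempty_modularParametrizationData)
    (hBCeven : ChiBranchLeadingTermAt W p) (hBCodd : ChiBranchLeadingTermOddAt W p)
    (hp2 : p ≠ 2) (hX : ClassX3Gord W p) (he : semistabilityIndex W p = 2) (hr : W.analyticRank = 0) :
    Gord.MissingInputAt W p ↔ MissingLowerBoundAt W p :=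
  ⟨fun h ↦ (lower_and_upper_of_missingPPartAt W p h).1, fun h ↦
    missingPPartAt_of_lower_of_upper W p h
      (ClassX3Gord.missingUpperBoundAt_rankZero_of_chiBranch' hDel hGZK hmod hmodD hBCeven hBCodd hp2
        hX he hr)⟩

end Summit.BirchSwinnertonDyer.Rank1Residual.Additive

end
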